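import Summits.AtomisticToContinuum.Crystallization.Theorems.MinimisingLawsHaveAtoms.Negative.Multiplicity
import Summits.AtomisticToContinuum.Crystallization.Theorems.MinimisingLawsHaveAtoms.Negative.DiffuseFamilyLaws
import Summits.AtomisticToContinuum.Crystallization.Theorems.MinimisingLawsHaveAtoms.Negative.RandomSpacingChain
import Summits.AtomisticToContinuum.Crystallization.Theorems.MinimisingLawsHaveAtoms.Negative.RandomSpacingChainEnergy
import Summits.AtomisticToContinuum.Crystallization.Theorems.MinimisingLawsHaveAtoms.Negative.RootedCombPair
import Summits.AtomisticToContinuum.Crystallization.Theorems.MinimisingLawsHaveAtoms.Negative.StrictCalibrationLatticeGap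
import Summits.AtomisticToContinuum.Crystallization.Theorems.MinimisingLawsHaveAtoms.Negative.ThresholdSharpness

/-!
# Disproof of `MinimisingLawsHaveAtoms` (stmt-AtomisticToContinuum-15776) — findings of the standing
# crux disprover (cdisprove, cycle 1, 2026-08-17; v4)

VERDICT SO FAR: **no kill; the crux resists because refuting it is an open problem.**  A
counterexample is exactly a DIFFUSE minimising point-stationary hard-core Lennard-Jones law (a
continuously or combinatorially degenerate infinite-volume LJ ground state of `ℝ³`), and
* any law with an atom at a rooted counting measure satisfies the conclusion
  (`Multiplicity.pos_rootedClass_of_dirac`), so a counterexample must be a law WITHOUT atoms on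
  `Measure ℝ³` (a continuum mixture of pairwise non-isometric configurations) — no `kit`
  computation and no finite family of configurations can refute the crux;
* "minimising" means EXACTLY `E_P[h] = e*` (`Multiplicity.integral_rootEnergy_eq_eStar`, landed
  Palm-side stability 9229; `minimisingLawsHaveAtoms_iff_exact`), and `e*` is not known (certified
  `−2³²/12 ≤ e* ≤ −1/2`), so the energy of a candidate can only be certified through an ABSTRACT
  minimiser (`MinimisingLawsCohesive.Negative.OnePointMixtures.exists_minimising_law`) of unknown
  structure;
* the printed degeneracy mechanisms are closed in tree: stacking disorder by the landed Hägg
  domination, parameter continua by `tube_hcpE_unique_minimiser` (see `STRATEGY-CENSUS.md`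
  §Negation); the third (amorphous / Frank–Kasper minimisers) IS the positive content of item 9225.

## What is kernel-checked (all landed under `Theorems/MinimisingLawsHaveAtoms/Negative/`, every
## file `--supports stmt-…-15776`; imported above, re-exported in §Index)

LOAD-BEARING ANALYSIS — EVERY hypothesis of the crux is certified load-bearing:
* hard core: `Multiplicity.minimisingLawsHaveAtoms_false_without_hardCore` (p169058) — the Dirac
  law at the weighted fcc lattice `c • count|fccD3 1` is point-stationary, probability, `E[h] ≤ e*`,
  charges no rooted class (class members are SIMPLE; hard core pins unit multiplicity);
* minimising: `RandomSpacingChain.minimisingLawsHaveAtoms_false_without_minimising` (p169640) — the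
  random-spacing chain `ℤ(1+eᵗ/3)e₀`, `t` uniform on `[0,1]`, is a point-stationary `1`-hard-core
  probability law charging NO rooted class (isometry-DIFFUSE): the frame carries diffuse laws;
* normalisation: `RandomSpacingChainEnergy.minimisingLawsHaveAtoms_false_without_probability`
  (p169683) — `(e*/E₁) • chainLaw` is finite, non-zero, point-stationary, hard-core, `∫ h = e*`
  exactly, no class charged: the energy hypothesis is not scale-invariant in `P`;
* point-stationarity: `RootedCombPair.minimisingLawsHaveAtoms_false_without_pointStationarity`
  (p170271) — the rooted comb (root energy `≤ e*`) with a far symmetric pair `±(10+eᵗ)e₁`: a.s.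
  hard-core probability law, `E[h] ≤ e*`, no class charged, not point-stationary.
THE MACHINE (`DiffuseFamilyLaws`, p169469; def-based twin `DiffuseFamilies`, p169318): laws of
continuous injective families `ℝ → RootedHardCoreConfig ℝ³ δ` pushed along the landed measurable
embedding `S ↦ count|S`: probability, a.s. hard-core, Mecke from the pointwise identity, and
`P(rootedClass Y) = 0 ∀ Y` from a separating isometry invariant.  ANY future refutation of the crux
(a diffuse minimising law) will be an instance of it with an energy certificate.
LINE `IdeatorOneSketch` (`StrictCalibrationLatticeGap`, p169341): the content stub
`stub_strictCalibrationHcp` ⇒ `e* < rootEnergy (count|L)` for EVERY `δ`-separated additive subgroup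
`L` of `ℝ³` (the divergence of every transfer vanishes at a lattice; strictness (ii) cannot fire:
lattice patches are centrosymmetric, the hcp patch of radius `11a/5` is not) ⇒
`e* < e(fccPC a)` for every `a > 0` — the stub carries a certified hcp-beats-every-Bravais-lattice
comparison (fcc: relative `10⁻⁴`, in tree only conditionally); negative lemma modulo "fcc optimal
at some scale" (`stub_strictCalibrationHcp_false_of_fcc_minimiser`).  `stub_hcpPatchRigid` is TRUE
(the `O(3)`-stabiliser of the 13-point relaxed anticuboctahedral patch is `D_3h ⊂ Sym(hcp)`; the box
keeps `B̄(0,23a/20) ∩ hcp` at 13 points since `2a/√3 > 23a/20`): no attack.  JOINT SUFFICIENCY of the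
skeleton: fine — it even proves full mass on ONE `hcpStacking a h` (PalmRigidity-strength).

## Cheap attacks that failed (why the crux resists)
junk Bochner value (`∫ = 0 > e*` falsifies the hypothesis; `e* ≤ −1/2`); one-point law, finite
clusters, combs (energy `> e*` on average or not point-stationary); zero-density defects /
half-crystals (no probability Palm law); rotations and re-rootings (the event is invariant);
mixtures (preserve atoms; cannot trade energy by exactness); on the content stub: `div t = 0` only
on self-invariant configurations, where (i) is the true `e(L) ≥ e*`; uniform rooting of finite
clusters sums (i) to the true `E_N ≥ N e*`.

## THRESHOLD SHARPNESS / TIGHTNESS (Parts VI–XIII, landed p170440 … p171075)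
`ThresholdSharpness.not_minimisingLawsHaveAtoms_at_relaxed_threshold` : **for every `e > e*` the
crux with `∫ h dP ≤ e` in place of `≤ e*` (everything else verbatim) is FALSE** — witness: the
abstract minimising law `P₀` (`exists_minimising_law`) pulled back to `RootedHardCoreConfig ℝ³ δ₀`
along the measurable embedding `S ↦ count|S` (`DilatedLawMecke.map_comap_toMeasure`) and DILATED
by an independent factor `c` uniform on `[1, 1+η]`:
* point-stationary (`DilatedLawMecke.isPointStationaryLaw_dilatedLaw`; Mecke covariance under
  similarities `IsPointStationaryLaw.map_mapSmul/.map_mapLinearIsometryEquiv`, file `MeckeCovariance`),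
  probability, a.s. `δ₀`-hard-core (dilation by `c ≥ 1` preserves separation,
  `DilationFamily.smul_image_rooted_separated`);
* energy `E[h] ≤ e* + 125 δ₀⁻⁶ · E[c − 1]` (`DilatedLawEnergy.integral_rootEnergy_dilatedLaw_le`,
  from the pointwise `lennardJones (c r) − lennardJones r ≤ (c−1) r⁻⁶` for `c ≥ 1` and the packing
  bound `∫ r⁻⁶ d(count|S) ≤ 250 δ⁻⁶`);
* charges NO rooted isometry class (`DilatedLawDiffuse.dilatedLaw_rootedClass_eq_zero`): the
  first-shell radius `ρ(S) = min {‖x‖ : x ∈ S ∖ 0}` is an isometry invariant taking countably many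
  values on a rooted class (`FirstShellRadius.firstShell_mem_of_mem_rootedClass`), `ρ(cS) = c ρ(S)`,
  and `c` is atomless — provided `ρ < ∞` a.s., i.e. the ONE-POINT configuration is `P₀`-null, which
  holds for EVERY law of the frame with `E[h] ≤ e*` (`OnePointNull.measure_setOf_eq_dirac_zero_eq_zero`:
  `{dirac 0}` is re-rooting invariant, restriction preserves Mecke, `h(dirac 0) = 0 > e*`).
Consequences: `ThresholdSharpness.exists_diffuse_law_lt` (diffuse frame laws at every level
`e > e*`), and `ThresholdSharpness.not_coercive_purity` — **the quantitative strengthening S⁺4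
("`E_P[h] − e* ≥ κ (1 − sup_Y P(rootedClass Y))` for some `κ > 0`") is FALSE**: purity, if true,
is NOT coercive / not stable; any proof must use `E[h] = e*` exactly (e.g. through first-order
optimality / calibration at the minimiser, as line `IdeatorOneSketch` does), never an energy-gap
or compactness-plus-lower-semicontinuity argument alone.

## ISOLATION IS NECESSARY (Part XIV, `Negative/IsolationNecessary.lean`, p171469 — submitted, dry-run ACCEPT,
## verdict pending at publication time; not yet imported here)
`minimisingLawsHaveAtoms_false_of_optimalPeriodicFamily`: a continuous one-parameter family
`t ↦ Q t` of pairwise non-isometric, `δ`-separated, OPTIMAL (`e(Q t) ≤ e*`, `t ∈ [0,1]`) periodic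
configurations refutes the crux — the `t`-mixture of the Palm laws `palmLaw (Q t)` is a diffuse
minimising law (`exists_diffuse_law_of_mixtureFamily`: the Part II machine for finite root
mixtures).  So the ISOLATION stub shared by lines `birth` (stub 3) and `perron_transfer` (stub 4) is
not a convenience: the crux itself implies that the (unknown) optimal periodic structures admit no
continuous non-isometric deformation at exact energy `e*` (no elastic / phason zero mode).

NEXT (if re-armed): (1) second-order tightness — is the crux false for laws with `E[h] = e*` but
hard-core parameter `δ → 0` dependent families (no: `δ` is existentially supplied, nothing to do);
(2) attack the lead's stuck stubs when `targets` is non-empty; (3) the only remaining kill is the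
open problem itself (a certified diffuse minimiser), which needs `e*` to accuracy `< 10⁻⁴·|e*|`.
-/

noncomputable section

namespace Summit.AtomisticToContinuum.Crystallization.Cruxes.MinimisingLawsHaveAtoms.Disproof

open MeasureTheory Set
open Literature.MathematicalPhysics.StatisticalMechanics Literature.Probability.Process
open Summit.AtomisticToContinuum.Crystallization.Theses.IsometryAtoms (MinimisingLawsHaveAtoms)
open Summit.AtomisticToContinuum.Crystallization.Theorems.MinimisingLawsHaveAtoms.Negative
open Summit.AtomisticToContinuum.Crystallization.Theorems.ChargedEnergyGapNegative (eStar)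

/-! ## Index of the landed negative lemmas (re-exported by `example`, so that this file breaks if
any of them changes) -/

example := Multiplicity.minimisingLawsHaveAtoms_iff_exact                      -- minimising = e* exactly
example := Multiplicity.minimisingLawsHaveAtoms_false_without_hardCore           -- hard core
example := RandomSpacingChain.minimisingLawsHaveAtoms_false_without_minimising   -- minimising
example := RandomSpacingChainEnergy.minimisingLawsHaveAtoms_false_without_probability  -- P(univ)=1
example := RootedCombPair.minimisingLawsHaveAtoms_false_without_pointStationarity      -- Mecke
example := @StrictCalibrationLatticeGap.eStar_lt_energyPerParticle_fccPC_of_stub       -- line stub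
example := @Literature.Probability.Process.IsPointStationaryLaw.map_mapSmul          -- Mecke under c•
example := @OnePointNull.measure_setOf_eq_dirac_zero_eq_zero                          -- one-point null
example := @DilatedLawEnergy.integral_rootEnergy_dilatedLaw_le                        -- energy of dilation
example := @DilatedLawDiffuse.dilatedLaw_rootedClass_eq_zero                          -- dilation diffuse
example := @ThresholdSharpness.exists_diffuse_law_lt                                  -- diffuse at e > e*
example := @ThresholdSharpness.not_minimisingLawsHaveAtoms_at_relaxed_threshold       -- TIGHTNESS
example := ThresholdSharpness.not_coercive_purity                                     -- ¬ S⁺4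
-- (pending p171469, then import `…Negative.IsolationNecessary` and re-export:)
-- example := @IsolationNecessary.minimisingLawsHaveAtoms_false_of_optimalPeriodicFamily

/-- **Summary theorem (for citation): the four deletions are false simultaneously.** [folklore] -/
theorem loadBearing_summary :
    (¬ (∀ P : Measure (Measure (EuclideanSpace ℝ (Fin 3))), IsProbabilityMeasure P →
      IsPointStationaryLaw P →
      (∫ μ, rootEnergy lennardJones μ ∂P) ≤
        (⨅ Q : PeriodicConfiguration 3, Q.energyPerParticle lennardJones) →
      ∃ Y : Set (EuclideanSpace ℝ (Fin 3)), 0 < P {μ | ∃ A : EuclideanSpace ℝ (Fin 3) →ₗᵢ[ℝ]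
        EuclideanSpace ℝ (Fin 3), ∃ q ∈ Y, μ = (Measure.count : Measure
          (EuclideanSpace ℝ (Fin 3))).restrict ((fun s => A (s - q)) '' Y)})) ∧
    (¬ (∀ δ : ℝ, 0 < δ → ∀ P : Measure (Measure (EuclideanSpace ℝ (Fin 3))), IsProbabilityMeasure P →
      (∀ᵐ μ ∂P, IsRootedHardCore δ μ) → IsPointStationaryLaw P →
      ∃ Y : Set (EuclideanSpace ℝ (Fin 3)), 0 < P {μ | ∃ A : EuclideanSpace ℝ (Fin 3) →ₗᵢ[ℝ]
        EuclideanSpace ℝ (Fin 3), ∃ q ∈ Y, μ = (Measure.count : Measure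
          (EuclideanSpace ℝ (Fin 3))).restrict ((fun s => A (s - q)) '' Y)})) ∧
    (¬ (∀ δ : ℝ, 0 < δ → ∀ P : Measure (Measure (EuclideanSpace ℝ (Fin 3))), IsFiniteMeasure P →
      P ≠ 0 → (∀ᵐ μ ∂P, IsRootedHardCore δ μ) → IsPointStationaryLaw P →
      (∫ μ, rootEnergy lennardJones μ ∂P) ≤
        (⨅ Q : PeriodicConfiguration 3, Q.energyPerParticle lennardJones) →
      ∃ Y : Set (EuclideanSpace ℝ (Fin 3)), 0 < P {μ | ∃ A : EuclideanSpace ℝ (Fin 3) →ₗᵢ[ℝ]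
        EuclideanSpace ℝ (Fin 3), ∃ q ∈ Y, μ = (Measure.count : Measure
          (EuclideanSpace ℝ (Fin 3))).restrict ((fun s => A (s - q)) '' Y)})) ∧
    (¬ (∀ δ : ℝ, 0 < δ → ∀ P : Measure (Measure (EuclideanSpace ℝ (Fin 3))), IsProbabilityMeasure P →
      (∀ᵐ μ ∂P, IsRootedHardCore δ μ) →
      (∫ μ, rootEnergy lennardJones μ ∂P) ≤
        (⨅ Q : PeriodicConfiguration 3, Q.energyPerParticle lennardJones) →
      ∃ Y : Set (EuclideanSpace ℝ (Fin 3)), 0 < P {μ | ∃ A : EuclideanSpace ℝ (Fin 3) →ₗᵢ[ℝ]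
        EuclideanSpace ℝ (Fin 3), ∃ q ∈ Y, μ = (Measure.count : Measure
          (EuclideanSpace ℝ (Fin 3))).restrict ((fun s => A (s - q)) '' Y)})) :=
  ⟨Multiplicity.minimisingLawsHaveAtoms_false_without_hardCore,
    RandomSpacingChain.minimisingLawsHaveAtoms_false_without_minimising,
    RandomSpacingChainEnergy.minimisingLawsHaveAtoms_false_without_probability,
    RootedCombPair.minimisingLawsHaveAtoms_false_without_pointStationarity⟩

/-- **Tightness summary (for citation): the energy threshold of the crux cannot be relaxed by any
`ε > 0`.** [folklore] -/
theorem threshold_tight (ε : ℝ) (hε : 0 < ε) :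
    ¬ (∀ δ : ℝ, 0 < δ → ∀ P : Measure (Measure (EuclideanSpace ℝ (Fin 3))), IsProbabilityMeasure P →
      (∀ᵐ μ ∂P, IsRootedHardCore δ μ) → IsPointStationaryLaw P →
      (∫ μ, rootEnergy lennardJones μ ∂P) ≤
        (⨅ Q : PeriodicConfiguration 3, Q.energyPerParticle lennardJones) + ε →
      ∃ Y : Set (EuclideanSpace ℝ (Fin 3)), 0 < P {μ | ∃ A : EuclideanSpace ℝ (Fin 3) →ₗᵢ[ℝ]
        EuclideanSpace ℝ (Fin 3), ∃ q ∈ Y, μ = (Measure.count : Measure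
          (EuclideanSpace ℝ (Fin 3))).restrict ((fun s => A (s - q)) '' Y)}) :=
  ThresholdSharpness.not_minimisingLawsHaveAtoms_at_relaxed_threshold
    (show eStar < eStar + ε by linarith)

end Summit.AtomisticToContinuum.Crystallization.Cruxes.MinimisingLawsHaveAtoms.Disproof

end
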